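import Literature.AnabelianGeometry.SemiGraphs.TemperedReconstructionReductions
import Literature.AnabelianGeometry.SemiGraphs.TemperedFunctorialityWith
import Literature.AnabelianGeometry.SemiGraphs.TemperedEdgeInVerticialProofs
import HarnessLib

/-!
# Semi-graphs of anabelioids, §3: the step (R3) `InducesOfCompatible` of Corollary 3.9, cut into
# sub-nodes (statements-first), with the composition proved

Mochizuki, *Semi-graphs of anabelioids*, Publ. RIMS **42** (2006), §3, Corollary 3.9, proof,
manuscript p. 43 ll. 6–14 [cite: MochizukiSemiAnbd2006, Cor 3.9 p.43]: "Next, we observe that if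
`φ : B^temp(G) → B^temp(H)` is quasi-geometric, then any morphism `φ' : B^temp(G') → B^temp(H')` induced
by `φ` between étale coverings of the domain and codomain of `φ` … is again quasi-geometric … Thus,
we obtain a morphism of graphs `G' → H'`, which is functorial in `G'`, `H'`.  Finally, by varying `G'`,
`H'`, we conclude that `φ` arises from a morphism of graphs of anabelioids which [again by Theorem
3.7, (iii), (iv)] is manifestly unique and locally open."

The reduction file (`TemperedReconstructionReductions.lean`, abc-iut-L3-t2, abc-iut-L3-d4) isolates the sentence
"`φ` arises from a morphism of graphs of anabelioids" as the named step (R3) `InducesOfCompatible`: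
a continuous `φ : π₁^temp(G) → π₁^temp(H)` compatible, up to conjugation, with a locally open
`F : G → H` on the verticial (`Hom.CompatV`) and the edge (`Hom.CompatE`) homomorphisms is INDUCED by
`F`, i.e. `B^temp(φ)` is the pull-back functor of `F`.  In the local presentation the pull-back functor
`F^*_θ` (`Hom.chartPullbackWith`, abc-iut-L3-t10) depends on a family `θ` of conjugating elements at
the branches (the 2-cells of Rmk. 2.4.2, recorded by `Hom.comm` only as `∃ g`), and two admissible
families differ by centralisers of branch images; so the faithful reading of "arises from `F`" is
`∃ θ, B^temp(φ) ≅ F^*_θ` (cell ruling ξ2; revision v3 of `TemperedReconstruction.lean` defines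
`Hom.Induces := ∃ θ, Hom.InducesWith θ …`).  This file targets that `∃ θ` form explicitly
(`∃ θ, Nonempty (F.chartPullbackWith θ c_G c_H ≅ BTemp.res φ)`), so it is independent of the
revision; the one-line identification with `InducesOfCompatible` is appended when v3 lands.

THE CUT (plan/L3/SUBDAG-SemiAnbd-Cor39.md row R3; the lead's headings «existence / uniqueness /
local openness» are realised as follows).
* (R3b, uniqueness — PROVED here, from Proposition 3.2 as landed: `BTemp.exists_conj_of_natTrans`,
  `BTemp.resIsoOfConj`): two homomorphisms inducing the same `F^*_θ` are `π₁^temp(H)`-conjugate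
  (`Hom.conj_of_chartPullbackWith_iso_both`); a conjugate of an induced homomorphism is induced
  (`Hom.chartPullbackWith_iso_of_conj`); an edge homomorphism at `e` is conjugate to the composite of
  a verticial homomorphism at an abutting vertex with the branch map (`conj_edgeHom_verticialHom_brHom`
  — the chart's gluings are translations).  Conversely an induced homomorphism is compatible — (R1)
  for every `θ`, abc-iut-L3-t10's `Hom.conj_of_chartPullbackWith_iso(_edge)`
  (`TemperedFunctorialityWithHom.lean`) — so that (R3) is an `iff` modulo the two leaves below.
* (R3c, where local openness enters — named sub-node `EdgeLikeCentralizer`, OPEN): for `H` as in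
  Cor. 3.9, the centraliser in `π₁^temp(H)` of the image of an OPEN subgroup of an edge group under an
  edge homomorphism lies in every verticial subgroup containing that image (print: "[again by Theorem
  3.7, (iii), (iv)]", l. 13; it is where the openness of the images of `F` is used: the discrepancy
  between the gluings of `B^temp(φ)` and of `F^*_θ` at a branch is a natural automorphism of the
  restriction to the edge group, i.e. — Prop. 3.2 — an element of such a centraliser).  Proof route
  for the holder: Thm. 3.7 (iii) `CompactInVerticial` (a nontrivial compact subgroup lies in at most
  two verticial subgroups), (ii) `VerticialDistinct` (verticial subgroups are self-normalising), the
  compactness of `⟨ψ(U), c⟩‾` for `c` in the centraliser, and total estrangement for loops.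
* (R3a, existence — named sub-node `TwistAbsorption`, OPEN): GIVEN (R3c) at `H`, a compatible `φ` IS
  induced for SOME family `θ`: the vertex and edge components of `B^temp(φ)` and `F^*_θ` are
  identified by the conjugators of `CompatV`/`CompatE` (Prop. 3.6 (iv), t10's
  `covPullbackWith_comp_restrictV/E`), and the branch discrepancies, which lie in the verticial
  subgroups by (R3c), are absorbed into `θ` ("by varying `G'`, `H'`, we conclude that `φ` arises from a
  morphism of graphs of anabelioids", ll. 12–13).
* COMPOSITION (PROVED): `chartPullbackWith_iso_of_compatible_of_subs :
  EdgeLikeCentralizer → TwistAbsorption → (∀ …, CompatV → CompatE → ∃ θ, B^temp(φ) ≅ F^*_θ)`.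

Honest framing: (R3a)/(R3c) are OUR paraphrases of one sentence of a printed proof, typed as named
`Prop`s to be PROVED in the cone (not facts; not in plan/FACT-LIST.md); typed ≠ proved; no statement
of the custody files (`TemperedReconstruction*.lean`, `TemperedVerticial.lean`) is altered; nothing
here takes a side on [IUTchIII] Cor. 3.12.
-/

noncomputable section

open CategoryTheory Topology

namespace Literature.AnabelianGeometry.SemiGraphs

namespace ProfiniteSemiGraph

universe u

variable {𝒢 ℋ : ProfiniteSemiGraph.{u}}

/-! ### (R3b) Rigidity — PROVED (Proposition 3.2: natural transformations between pull-back
functors are translations by elements of the tempered group) -/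

namespace Hom

variable (F : Hom 𝒢 ℋ) (θ : F.ConjugatorFamily) (c𝒢 : TemperedPiChart 𝒢) (cℋ : TemperedPiChart ℋ)

/-- A `π₁^temp(H)`-conjugate of a homomorphism inducing `F^*_θ` induces `F^*_θ`
(`B^temp(γ_g ∘ φ₀) ≅ B^temp(φ₀)`, [SemiAnbd] Prop. 3.2 p. 35 "in particular").
[cite: MochizukiSemiAnbd2006, Prop 3.2 p.35] -/
theorem chartPullbackWith_iso_of_conj {φ₀ φ : c𝒢.G →ₜ* cℋ.G}
    (h₀ : Nonempty (F.chartPullbackWith θ c𝒢 cℋ ≅ BTemp.res φ₀)) (g : cℋ.G)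
    (hg : ∀ x, g * φ₀ x * g⁻¹ = φ x) :
    Nonempty (F.chartPullbackWith θ c𝒢 cℋ ≅ BTemp.res φ) :=
  ⟨h₀.some ≪≫ BTemp.resIsoOfConj φ₀ φ g hg⟩

/-- **Uniqueness up to conjugation** ([SemiAnbd] Prop. 3.2 p. 35; Cor. 3.9 p. 43 "manifestly unique"):
two homomorphisms `π₁^temp(G) → π₁^temp(H)` inducing the same pull-back functor `F^*_θ` are conjugate
by an element of `π₁^temp(H)`. [cite: MochizukiSemiAnbd2006, Prop 3.2 p.35] -/
theorem conj_of_chartPullbackWith_iso_both {φ ψ : c𝒢.G →ₜ* cℋ.G}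
    (hφ : Nonempty (F.chartPullbackWith θ c𝒢 cℋ ≅ BTemp.res φ))
    (hψ : Nonempty (F.chartPullbackWith θ c𝒢 cℋ ≅ BTemp.res ψ)) :
    ∃ g : cℋ.G, ∀ x, g * φ x * g⁻¹ = ψ x := by
  obtain ⟨e⟩ := hφ
  obtain ⟨e'⟩ := hψ
  obtain ⟨g, hg, -⟩ := BTemp.exists_conj_of_natTrans cℋ.isTempered φ ψ (e.symm ≪≫ e').hom
  exact ⟨g, hg⟩

end Hom

/-- **The chart's gluings are translations** ([SemiAnbd] §3 p. 36 — an object of `B^temp(G)` carries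
gluings `S_e ≅ b^* S_v` — with Prop. 3.2 p. 35): for a branch `b` of `e` abutting to `v`, an edge
homomorphism `ψ_e` at `e` and a verticial homomorphism `ψ_v` at `v`, the homomorphisms `ψ_e` and
`ψ_v ∘ b_*` are conjugate in `π₁^temp(G)` — the element-level form of abc-iut-L3-t11's
`nonempty_res_iso_res_comp_brHom` (`B^temp(ψ_e) ≅ B^temp(ψ_v ∘ b_*)`) via Yoneda on the Galois
objects (`BTemp.exists_conj_of_natTrans`, which moreover identifies the natural isomorphism with the
translation by the conjugating element). [cite: MochizukiSemiAnbd2006, Thm 3.7(iii) p.41] -/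
theorem conj_edgeHom_verticialHom_brHom (c : TemperedPiChart 𝒢) {b : 𝒢.graph.Branch}
    {v : 𝒢.graph.Vertex} (h : 𝒢.graph.abuts b = some v)
    {ψe : 𝒢.Ge (𝒢.graph.edgeOf b) →ₜ* c.G} {ψv : 𝒢.Gv v →ₜ* c.G}
    (he : IsEdgeHom c (𝒢.graph.edgeOf b) ψe) (hv : IsVerticialHom c v ψv) :
    ∃ k : c.G, ∀ x, k * ψe x * k⁻¹ = ψv (𝒢.brHom b v h x) := by
  obtain ⟨iE⟩ := he
  obtain ⟨iV⟩ := hv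
  obtain ⟨i⟩ := nonempty_res_iso_res_comp_brHom c b v h ψe ψv iE iV
  obtain ⟨k, hk, -⟩ := BTemp.exists_conj_of_natTrans c.isTempered ψe (ψv.comp (𝒢.brHom b v h)) i.hom
  exact ⟨k, hk⟩

/-! ### (R3c) The named sub-node: centralisers of open pieces of edge-like subgroups -/

/-- (R3c), one graph at a time: *in `π₁^temp(H)` (chart `c`), the centraliser of the image `ψ(U)` of
an OPEN subgroup `U ⊆ Π_e` under an edge homomorphism `ψ` at `e` lies in every verticial subgroup `H_v`
containing `ψ(U)`.*  (Under the hypotheses of Cor. 3.9, `Π_e` is infinite — total aloofness at an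
elevated vertex — so `U ≠ 1`, and `ψ(U)` is a nontrivial compact subgroup of the edge-like subgroup
`ψ(Π_e)`, which lies in the verticial subgroups at the two end-vertices of the [closed] edge `e`.)
The group-theoretic input of the last sentence of the proof of [SemiAnbd] Cor. 3.9 (p. 43 l. 13
"[again by Theorem 3.7, (iii), (iv)]"): it is the point where the LOCAL OPENNESS of `F` is used.
A named statement, not asserted. [cite: MochizukiSemiAnbd2006, Cor 3.9 p.43] -/
def EdgeLikeCentralizerAt (ℋ : ProfiniteSemiGraph.{u}) (c : TemperedPiChart ℋ) : Prop :=
  ∀ (e : ℋ.graph.Edge) (ψ : ℋ.Ge e →ₜ* c.G), IsEdgeHom c e ψ →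
    ∀ (U : Subgroup (ℋ.Ge e)), IsOpen (U : Set (ℋ.Ge e)) →
      ∀ (v : ℋ.graph.Vertex) (H : Subgroup c.G), H ∈ verticialSubgroups c v →
        U.map ψ.toMonoidHom ≤ H →
          Subgroup.centralizer ((U.map ψ.toMonoidHom : Subgroup c.G) : Set c.G) ≤ H

/-- **(R3c) `EdgeLikeCentralizer`** — sub-node of [SemiAnbd] Cor. 3.9, step (R3) (p. 43 l. 13): for
every `H` satisfying the hypotheses of Corollary 3.9 ("connected, countable, quasi-coherent, totally
elevated, totally estranged, verticially slim graph of anabelioids") and every chart of `π₁^temp(H)`,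
`EdgeLikeCentralizerAt H c`.  Named sub-node (OUR paraphrase of a proof step, to be proved from
Thm. 3.7 (ii) `VerticialDistinct`, (iii) `CompactInVerticial` and total estrangement); not asserted.
[cite: MochizukiSemiAnbd2006, Cor 3.9 p.43] -/
def EdgeLikeCentralizer : Prop :=
  ∀ (ℋ : ProfiniteSemiGraph.{u}), Cor39Hypotheses ℋ → ∀ (c : TemperedPiChart ℋ),
    EdgeLikeCentralizerAt ℋ c

/-! ### (R3a) The named sub-node: a compatible homomorphism is induced for SOME family of
conjugating elements -/

/-- **(R3a) `TwistAbsorption`** — sub-node of [SemiAnbd] Cor. 3.9, step (R3) (p. 43 ll. 12–13: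
"by varying `G'`, `H'`, we conclude that `φ` arises from a morphism of graphs of anabelioids"), the
EXISTENCE half given the group-theoretic input (R3c) at `H`: for `G`, `H` as in Corollary 3.9 with
charts `c_G`, `c_H`, IF `EdgeLikeCentralizerAt H c_H` holds, then every continuous
`φ : π₁^temp(G) → π₁^temp(H)` that is compatible, up to conjugation, with a locally open `F : G → H` on
the verticial homomorphisms (`Hom.CompatV`) and on the edge homomorphisms (`Hom.CompatE`) induces the
pull-back functor of `F` glued along SOME family `θ` of conjugating elements:
`B^temp(φ) ≅ c_H⁻¹ ⋙ F^*_θ ⋙ c_G`.  (Route: the conjugators of `CompatV`/`CompatE` identify the vertex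
and edge components of the two functors — Prop. 3.6 (iv), `covPullbackWith_comp_restrictV/E`; the
residual branch discrepancies are natural automorphisms of the edge restrictions, i.e. (Prop. 3.2)
elements of the centralisers of the open images `F_e(Π_e)`, which (R3c) places inside the verticial
subgroups, where they are absorbed into `θ`.)  Named sub-node, OUR paraphrase; not asserted.
[cite: MochizukiSemiAnbd2006, Cor 3.9 p.43] -/
def TwistAbsorption : Prop :=
  ∀ (𝒢 ℋ : ProfiniteSemiGraph.{u}), Cor39Hypotheses 𝒢 → Cor39Hypotheses ℋ →
    ∀ (c𝒢 : TemperedPiChart 𝒢) (cℋ : TemperedPiChart ℋ), EdgeLikeCentralizerAt ℋ cℋ →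
      ∀ (F : Hom 𝒢 ℋ) (φ : c𝒢.G →ₜ* cℋ.G),
        F.IsLocallyOpen → F.CompatV c𝒢 cℋ φ → F.CompatE c𝒢 cℋ φ →
          ∃ θ : F.ConjugatorFamily, Nonempty (F.chartPullbackWith θ c𝒢 cℋ ≅ BTemp.res φ)

/-! ### The composition — PROVED -/

/-- **(R3) from (R3a) + (R3c)**, in the `∃ θ` form of "induced" (ruling ξ2 / revision v3 of
`Hom.Induces`): under the hypotheses of [SemiAnbd] Cor. 3.9, a homomorphism compatible up to
conjugation with a locally open `F` on the verticial and edge homomorphisms induces `F^*_θ` for some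
family `θ` of conjugating elements ("`φ` arises from a morphism of graphs of anabelioids", p. 43
ll. 12–13). [cite: MochizukiSemiAnbd2006, Cor 3.9 p.43] -/
theorem chartPullbackWith_iso_of_compatible_of_subs (hR3c : EdgeLikeCentralizer.{u})
    (hR3a : TwistAbsorption.{u}) (h𝒢 : Cor39Hypotheses 𝒢) (hℋ : Cor39Hypotheses ℋ)
    (c𝒢 : TemperedPiChart 𝒢) (cℋ : TemperedPiChart ℋ) (F : Hom 𝒢 ℋ) (φ : c𝒢.G →ₜ* cℋ.G)
    (hF : F.IsLocallyOpen) (hV : F.CompatV c𝒢 cℋ φ) (hE : F.CompatE c𝒢 cℋ φ) :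
    ∃ θ : F.ConjugatorFamily, Nonempty (F.chartPullbackWith θ c𝒢 cℋ ≅ BTemp.res φ) :=
  hR3a 𝒢 ℋ h𝒢 hℋ c𝒢 cℋ (hR3c ℋ hℋ cℋ) F φ hF hV hE

/-- Consequence for the CHOSEN family (the tree's `Hom.chartPullback`, hence the v2 reading of
`Hom.Induces`): if the absorbing family of (R3a) happens to be the chosen one, `φ` is induced in the
v2 sense — recorded to make the dependence on `θ` explicit (in general the absorbing family is NOT
the chosen one: cell finding d4-F3 / ruling ξ2). [cite: MochizukiSemiAnbd2006, Prop 3.6(iv) p.39] -/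
theorem chartPullback_iso_of_chartPullbackWith_chosen (F : Hom 𝒢 ℋ) (c𝒢 : TemperedPiChart 𝒢)
    (cℋ : TemperedPiChart ℋ) (φ : c𝒢.G →ₜ* cℋ.G)
    (h : Nonempty (F.chartPullbackWith F.chosenConjugators c𝒢 cℋ ≅ BTemp.res φ)) :
    Nonempty (F.chartPullback c𝒢 cℋ ≅ BTemp.res φ) := by
  rw [F.chartPullback_eq_chartPullbackWith]
  exact h

end ProfiniteSemiGraph

end Literature.AnabelianGeometry.SemiGraphs

end
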